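import Literature.MathematicalPhysics.QuantumFieldTheory.YangMillsOS
import Literature.Probability.LatticeModels.TransferOperator

/-!
# Sketch (ideator 2, round 1) for crux `GapToContinuum` (stmt-QuantumFields-8896)

First-lemma signatures for the idea cards

* `purity-subspace-transfer` — the PURITY SET of a positive contraction (vectors whose diagonal
  matrix coefficients decay at rate `θ` with their OWN squared norm as constant) is a closed,
  `A`-invariant, isometry-invariant submodule; rate-only bounds with ANY constant land in it
  (`RateOnlyPurity`, via the sibling's proved `selfImprovingDecay`); one-leg sharp clustering of
  the OS data (`OneLegSharpClustering`) and the two implication stubs `OneLegFromLatticeGap`,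
  `MixedClausesFromOneLeg`; the residual `PhysicalScaleThresholds`.
* `dark-state-spectroscopy` — Baire uniformisation on a fixed edge box (`BoxUniformThreshold`),
  the k-free quotient `NoDarkLightStates` and the abstract assembly `FullGapFromNoDark`.

Everything here is a `Prop`-valued definition (statement only) except the two small lemmas
`isClosed_puritySet`, `puritySet_isometry_mem`, which are proved.
-/

namespace Summit.QuantumFields.YangMills.Cruxes.GapToContinuum.SketchIdeator2

/- Imports: only the Literature interface the crux is stated over (`YangMillsOS`: `LatticeRep`,
`SpeciesScheme`, `YMSpecies`, `OSData`, `IsYangMillsFor`, `HasLatticeMassGap`, `latticeConnectedCorr`)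
and the tree's abstract transfer-operator vocabulary; no route declaration is referenced, so the route
file `Theses/LangevinControlUV.lean` is deliberately not imported (the crux's binders are copied
verbatim in `gapToContinuum_of_stubs`). -/

open scoped InnerProductSpace SchwartzMap
open Filter Topology
open Literature.MathematicalPhysics.QuantumLattice Literature.MathematicalPhysics.AQFT
open Literature.MathematicalPhysics.QuantumFieldTheory Literature.Probability.LatticeModels

noncomputable section

/-! ## 1. The purity set of a bounded operator -/

section Purity

variable {H : Type*} [NormedAddCommGroup H] [InnerProductSpace ℂ H] [CompleteSpace H]

/-- **Purity set** of `A` at rate `θ`: the vectors `v` with `Re ⟪v, Aⁿ v⟫ ≤ θⁿ ‖v‖²` for all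
`n`. For a positive contraction `A = T P_{Ω^⊥}` (transfer operator off the vacuum) and
`θ = e^{-Δ a}` this is exactly the spectral subspace of `A` for `[0, θ]` — written without the
spectral theorem. -/
def puritySet (A : H →L[ℂ] H) (θ : ℝ) : Set H :=
  {v | ∀ n : ℕ, RCLike.re ⟪v, (A ^ n) v⟫_ℂ ≤ θ ^ n * ‖v‖ ^ 2}

omit [CompleteSpace H] in
/-- The purity set is closed (an intersection of closed sublevel sets of continuous maps). -/
theorem isClosed_puritySet (A : H →L[ℂ] H) (θ : ℝ) : IsClosed (puritySet A θ) := by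
  have : puritySet A θ = ⋂ n : ℕ, {v : H | RCLike.re ⟪v, (A ^ n) v⟫_ℂ ≤ θ ^ n * ‖v‖ ^ 2} := by
    ext v; simp [puritySet]
  rw [this]
  refine isClosed_iInter fun n => ?_
  apply isClosed_le
  · exact RCLike.continuous_re.comp (Continuous.inner continuous_id (A ^ n).continuous)
  · exact continuous_const.mul ((continuous_norm).pow 2)

omit [CompleteSpace H] in
/-- The purity set is invariant under every isometry commuting with `A` (spatial lattice
translations commute with the transfer operator and fix the vacuum). -/
theorem puritySet_isometry_mem (A U : H →L[ℂ] H) (θ : ℝ)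
    (hU : ∀ v w : H, ⟪U v, U w⟫_ℂ = ⟪v, w⟫_ℂ) (hcomm : U.comp A = A.comp U)
    {v : H} (hv : v ∈ puritySet A θ) : U v ∈ puritySet A θ := by
  have hpow : ∀ n : ℕ, (A ^ n) (U v) = U ((A ^ n) v) := by
    intro n
    induction n with
    | zero => simp
    | succ n ih =>
      have h1 : A (U ((A ^ n) v)) = U (A ((A ^ n) v)) := by
        have := congrArg (fun f : H →L[ℂ] H => f ((A ^ n) v)) hcomm
        simpa using this.symm
      calc (A ^ (n + 1)) (U v) = A ((A ^ n) (U v)) := by rw [pow_succ']; rfl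
        _ = A (U ((A ^ n) v)) := by rw [ih]
        _ = U (A ((A ^ n) v)) := h1
        _ = U ((A ^ (n + 1)) v) := by rw [pow_succ']; rfl
  have hnorm : ‖U v‖ = ‖v‖ := by
    have h := hU v v
    rw [inner_self_eq_norm_sq_to_K, inner_self_eq_norm_sq_to_K] at h
    have h' : (‖U v‖ : ℝ) ^ 2 = ‖v‖ ^ 2 := by exact_mod_cast h
    exact (sq_eq_sq₀ (norm_nonneg _) (norm_nonneg _)).1 h'
  intro n
  rw [hpow n, hU, hnorm]
  exact hv n

/-- **L1 (rate-only ⇒ sharp).** For a positive contraction `A` and `0 < θ ≤ 1`, a vector whose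
diagonal coefficients obey `Re ⟪v, Aⁿ v⟫ ≤ C θⁿ` for SOME `C` lies in the purity set (the
constant improves to `‖v‖²`). Content: `n ↦ Re ⟪v, Aⁿ v⟫` is non-negative and log-convex
(self-adjoint square root of `A`, Cauchy–Schwarz), then the sibling's proved
`Cruxes.OSLegsFromFemtoAndGap.SketchIdeator2.selfImprovingDecay`. -/
def RateOnlyPurity : Prop :=
  ∀ (H : Type) [NormedAddCommGroup H] [InnerProductSpace ℂ H] [CompleteSpace H]
    (A : H →L[ℂ] H), A.IsPositive → ‖A‖ ≤ 1 → ∀ θ : ℝ, 0 < θ → θ ≤ 1 →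
      ∀ (v : H) (C : ℝ), (∀ n : ℕ, RCLike.re ⟪v, (A ^ n) v⟫_ℂ ≤ C * θ ^ n) →
        v ∈ puritySet A θ

/-- **L2 (purity SUBMODULE).** For a positive contraction the purity set is a (closed) linear
subspace invariant under `A`: sums via Cauchy–Schwarz give a rate-only bound with constant
`(‖v‖ + ‖w‖)²`, which L1 sharpens; `A v` via the rate-only bound with constant `θ² ‖v‖²`.
This linearity is what absorbs the smearing sums `∑ₓ f(a x) (Âₓ − m) Ω` of ONE species. -/
def PuritySubmodule : Prop :=
  ∀ (H : Type) [NormedAddCommGroup H] [InnerProductSpace ℂ H] [CompleteSpace H]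
    (A : H →L[ℂ] H), A.IsPositive → ‖A‖ ≤ 1 → ∀ θ : ℝ, 0 < θ → θ ≤ 1 →
      ∃ E : Submodule ℂ H, (E : Set H) = puritySet A θ ∧ ∀ v ∈ E, A v ∈ E

/-- **L3 (purity in an OS realisation is what rate-only clustering says).** In the tree's
abstract OS realisation `(H, ι, D)` of a probability measure, a bounded positive-time
observable `F` whose diagonal time correlation decays at rate `m` with SOME constant has
`P_{Ω^⊥} ι F` in the purity set of `T` at rate `e^{-m}` — per observable, no uniformity over
observables needed (contrast `timeClustering_iff_massGap`, which needs ALL `F`). -/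
def PurityOfClusteringObservable : Prop :=
  ∀ {Ω : Type} [MeasurableSpace Ω] (μ : MeasureTheory.Measure Ω)
    [MeasureTheory.IsProbabilityMeasure μ] (reflect shift : Ω → Ω) (mpos : MeasurableSpace Ω)
    {H : Type} [NormedAddCommGroup H] [InnerProductSpace ℂ H] [CompleteSpace H]
    (ι : (Ω → ℂ) → H) (D : TransferData H), IsOSRealisation μ reflect shift mpos ι D →
    ∀ (m : ℝ), 0 < m → ∀ (F : Ω → ℂ), IsBoundedMeasurable mpos F →
      (∃ C : ℝ, ∀ t : ℕ, ‖(∫ ω, (starRingEnd ℂ) (F (reflect ω)) * F (shift^[t] ω) ∂μ) -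
          (∫ ω, (starRingEnd ℂ) (F (reflect ω)) ∂μ) * (∫ ω, F ω ∂μ)‖ ≤ C * Real.exp (-m * t)) →
      (ι F - ⟪D.vacuum, ι F⟫_ℂ • D.vacuum) ∈ puritySet D.T (Real.exp (-m))

end Purity

/-! ## 2. One-leg sharp clustering of OS data and the two implication stubs -/

section OneLeg

/-- Euclidean `ℝ⁴`. -/
abbrev E4 : Type := EuclideanSpace ℝ (Fin 4)

/-- **One-leg sharp clustering at rate `Δ`** of OS data `T`: for every species `s` and every
time-ordered one-point `F`, the diagonal truncated two-point function
`u(t) = 𝔖₂(ΘF* ⊗ T_t F) − |𝔖₁(F)|²` obeys `u(t) ≤ e^{-Δ t} u(0)` — the Laplace transform of the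
spectral measure of `Ψ_F − ⟨Ψ_F⟩Ω` has no mass in `(0, Δ)`; the constant is `u(0) = ‖Ψ_F‖²_⊥`. -/
def OneLegSharpClustering {ι : Type} (T : OSData ι 4) (Δ : ℝ) : Prop :=
  ∀ (s : ι) (F : 𝓢((Fin 1 → E4), ℂ)), IsTimeOrdered F →
    ∀ H₀ : 𝓢((Fin (1 + 1) → E4), ℂ), IsAppendTensorOf H₀ (osAdjoint F) F →
      ∀ t : ℝ, 0 ≤ t → ∀ Ht : 𝓢((Fin (1 + 1) → E4), ℂ),
        IsAppendTensorOf Ht (osAdjoint F) (translateMulti (EuclideanSpace.single 0 t) F) →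
          (T.schwinger (1 + 1) (fun _ => s) Ht
              - T.schwinger 1 (fun _ => s) (osAdjoint F) * T.schwinger 1 (fun _ => s) F).re
            ≤ Real.exp (-Δ * t) *
              (T.schwinger (1 + 1) (fun _ => s) H₀
                - T.schwinger 1 (fun _ => s) (osAdjoint F) * T.schwinger 1 (fun _ => s) F).re

/-- **Stub S1 (lattice ⟶ continuum, one leg; the load-bearing transfer).** From the hypotheses
of `GapToContinuum` AS TYPED (per-pair constants, per-pair thresholds) plus `β_k ≥ 0`
eventually (odd-torus reflection positivity; supplied for free by `sch.HasWeakCouplingLimit`,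
which `closes` holds): every one-leg vector of `T` is pure. Chain: S → ∞ RP limit state at step
`k` ⟶ L3 for the ONE pair `(ΘA·shift, A)` at its own threshold ⟶ L2 absorbs the smearing sum
(translates and time-shifts of one species) ⟶ Laplace transforms converge (`IsYangMillsFor` on
off-diagonal two-point tensors, `t ∈ a_k ℕ` + equicontinuity) ⟶ portmanteau: mass of the open
set `(0, Δ)` is upper semicontinuous under weak limits, hence `0`. -/
def OneLegFromLatticeGap : Prop :=
  ∀ (G : Type) [Group G] [TopologicalSpace G] [IsTopologicalGroup G] [CompactSpace G]
    [MeasurableSpace G] [BorelSpace G] (r : LatticeRep G) (sch : SpeciesScheme (YMSpecies G))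
    (T : OSData (YMSpecies G) 4) (Δ : ℝ), 0 < Δ → (∀ᶠ k in atTop, 0 ≤ sch.β k) →
      IsYangMillsFor r sch T → HasLatticeMassGap r sch Δ → OneLegSharpClustering T Δ

/-- **Stub S2 (pure OS bookkeeping).** One-leg sharp clustering gives every `(1, m)` clause of
`OSData.HasMassGap` with constant `‖Ψ_F‖_⊥ ‖Ψ_G‖`: one-sided Cauchy–Schwarz in the RP form,
`|⟨(1−P_Ω)Ψ_F, e^{-tH} Ψ_G⟩| ≤ ‖e^{-tH}(1−P_Ω)Ψ_F‖ ‖Ψ_G‖` and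
`‖e^{-tH}(1−P_Ω)Ψ_F‖² = u(2t) ≤ e^{-2Δt} u(0)`. (The `(n, 1)` clauses follow by hermiticity E0.) -/
def MixedClausesFromOneLeg : Prop :=
  ∀ {ι : Type} (T : OSData ι 4) (Δ : ℝ), 0 < Δ → OneLegSharpClustering T Δ →
    ∀ (m : ℕ) (s : ι) (k' : Fin m → ι) (F : 𝓢((Fin 1 → E4), ℂ)) (G : 𝓢((Fin m → E4), ℂ)),
      IsTimeOrdered F → IsTimeOrdered G →
        ∃ C : ℝ, ∀ t : ℝ, 0 ≤ t → ∀ Hfg : 𝓢((Fin (1 + m) → E4), ℂ),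
          IsAppendTensorOf Hfg (osAdjoint F) (translateMulti (EuclideanSpace.single 0 t) G) →
            ‖T.schwinger (1 + m) (Fin.append ((fun _ : Fin 1 => s) ∘ Fin.rev) k') Hfg
                - T.schwinger 1 ((fun _ : Fin 1 => s) ∘ Fin.rev) (osAdjoint F)
                  * T.schwinger m k' G‖ ≤ C * Real.exp (-Δ * t)

end OneLeg

/-! ## 3. The residual, typed: thresholds uniform over ONE physical scale -/

section Residual

variable {G : Type} [Group G] [TopologicalSpace G] [IsTopologicalGroup G] [CompactSpace G]
  [MeasurableSpace G] [BorelSpace G]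

/-- The edge support of a species lies in the sup-norm box of radius `R` about the origin. -/
def SuppInBox (A : YMSpecies G) (R : ℝ) : Prop :=
  ∀ e ∈ A.supp, ∀ i : Fin 4, |((e.1 i : ℤ) : ℝ)| ≤ R

/-- **Residual R = `PhysicalScaleThresholds`** (what the multi-leg clauses need beyond S1/S2, in
its weakest sufficient form): there is ONE physical scale `s⋆ > 0` such that, eventually in `k`,
EVERY pair of species supported in the box of lattice radius `s⋆ / a_k` (in particular the
reflection-paired diagonal `(ΘA·shift, A)`, which is all purity uses) has its time correlation decaying
at rate `Δ a_k` volume-uniformly (any constant — purity needs none).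
Euclidean Reeh–Schlieder analyticity (Glimm–Jaffe Cor. 19.5.4–19.5.6, Prop. 19.6.2) upgrades
purity of multi-leg vectors with legs inside a ball of radius `s⋆` to all multi-leg vectors.
NOT a consequence of `HasLatticeMassGap` as typed (sandwich leak); immediate from the
pair-uniform restatement `∃ k₀ ∀ A B ∃ C ∀ k ≥ k₀ …` the refuters recommend. -/
def PhysicalScaleThresholds (r : LatticeRep G) (sch : SpeciesScheme (YMSpecies G)) (Δ : ℝ) :
    Prop :=
  ∃ s : ℝ, 0 < s ∧ ∀ᶠ k in atTop, ∀ A B : YMSpecies G,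
    SuppInBox A (s / sch.a k) → SuppInBox B (s / sch.a k) →
      ∃ C : ℝ, ∀ S : ℕ, sch.L k ≤ S → ∀ n : ℕ, n ≤ S →
        |latticeConnectedCorr r.ρ (sch.β k) (2 * S + 1) A.F B.F n| ≤
          C * Real.exp (-(Δ * (sch.a k * n)))

/-- **Stub S3 (residual ⟶ crux).** Given S1's output and R, every clause of `T.HasMassGap Δ`:
multi-leg lattice vectors split at lattice radius `s⋆/(2 a_k)`; the near part is pure by L2 + R,
the far part is handled by analyticity (its purity is not needed: Reeh–Schlieder density of the
near vectors). -/
def CruxFromOneLegAndThresholds : Prop :=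
  ∀ (G : Type) [Group G] [TopologicalSpace G] [IsTopologicalGroup G] [CompactSpace G]
    [MeasurableSpace G] [BorelSpace G] (r : LatticeRep G) (sch : SpeciesScheme (YMSpecies G))
    (T : OSData (YMSpecies G) 4) (Δ : ℝ), 0 < Δ → (∀ᶠ k in atTop, 0 ≤ sch.β k) →
      IsYangMillsFor r sch T → OneLegSharpClustering T Δ → PhysicalScaleThresholds r sch Δ →
        T.HasMassGap Δ

/-- Sanity: the three stubs and the `β ≥ 0` side condition compose to the crux restricted to
schemes with eventually non-negative coupling and physical-scale thresholds (pure logic). -/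
theorem gapToContinuum_of_stubs (h1 : OneLegFromLatticeGap) (h3 : CruxFromOneLegAndThresholds)
    (G : Type) [Group G] [TopologicalSpace G] [IsTopologicalGroup G] [CompactSpace G]
    [MeasurableSpace G] [BorelSpace G] (r : LatticeRep G) (sch : SpeciesScheme (YMSpecies G))
    (T : OSData (YMSpecies G) 4) (Δ : ℝ) (hΔ : 0 < Δ) (hβ : ∀ᶠ k in atTop, 0 ≤ sch.β k)
    (hYM : IsYangMillsFor r sch T) (hgap : HasLatticeMassGap r sch Δ)
    (hR : PhysicalScaleThresholds r sch Δ) : T.HasMassGap Δ :=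
  h3 G r sch T Δ hΔ hβ hYM (h1 G r sch T Δ hΔ hβ hYM hgap) hR

end Residual

/-! ## 4. Baire uniformisation on a fixed edge box (card `dark-state-spectroscopy`) -/

section Baire

variable {G : Type} [Group G] [TopologicalSpace G] [IsTopologicalGroup G] [CompactSpace G]
  [MeasurableSpace G] [BorelSpace G]

/-- **Baire uniformisation.** For a FIXED finite edge box, the per-pair clause of
`HasLatticeMassGap` upgrades to a box-uniform threshold and a constant `C_Λ ‖A‖_∞ ‖B‖_∞`:
the species supported in the box with sup norm form a Banach space, the sets
`{(A,B) | ∀ k ≥ N, … ≤ C}` are closed, bilinearity + Baire category (Osgood) give a ball, and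
polarisation spreads it. Uniform over FUNCTIONS on the box — not over boxes (the union over
boxes is an LB-space, not Baire): this is why the residual is about supports, not constants. -/
def BoxUniformThreshold (r : LatticeRep G) (sch : SpeciesScheme (YMSpecies G)) (Δ : ℝ) : Prop :=
  HasLatticeMassGap r sch Δ → ∀ Λ : Finset (ZdEdge 4), ∃ (N : ℕ) (CΛ : ℝ),
    ∀ A B : YMSpecies G, A.supp ⊆ Λ → B.supp ⊆ Λ →
      ∀ MA MB : ℝ, (∀ U, |A.F U| ≤ MA) → (∀ U, |B.F U| ≤ MB) →
        ∀ k : ℕ, N ≤ k → ∀ S : ℕ, sch.L k ≤ S → ∀ n : ℕ, n ≤ S →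
          |latticeConnectedCorr r.ρ (sch.β k) (2 * S + 1) A.F B.F n| ≤
            CΛ * MA * MB * Real.exp (-(Δ * (sch.a k * n)))

end Baire

/-! ## 5. The k-free quotient: no dark light states (card `dark-state-spectroscopy`) -/

section Dark

variable {H : Type*} [NormedAddCommGroup H] [InnerProductSpace ℂ H] [CompleteSpace H]

/-- **No dark light states** for a transfer datum `D`, a family `𝒜` of "one-insertion" vectors
(the images `ι A` of the positive-time translates of a box algebra) and a rate `θ`: every vector
orthogonal to the vacuum and to ALL time-evolved one-insertion vectors `Tⁿ a`, `a ∈ 𝒜`, is pure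
at rate `θ` — i.e. the spectral subspace of `T` for `(θ, 1)` lies inside the closed `T`-cyclic
span of `𝒜`. With `𝒜 ⊆ puritySet` (Baire + L3 at step `k`) this forces the FULL transfer gap
`θ`; it is the exact quotient "uniform lattice gap ⁄ per-species `HasLatticeMassGap`". -/
def NoDarkLightStates (D : TransferData H) (𝒜 : Set H) (θ : ℝ) : Prop :=
  ∀ v : H, ⟪D.vacuum, v⟫_ℂ = 0 → (∀ a ∈ 𝒜, ∀ n : ℕ, ⟪(D.T ^ n) a, v⟫_ℂ = 0) →
    v ∈ puritySet D.T θ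

/-- **Full gap from purity of one-insertion vectors + no dark light states** (the assembly of
card `dark-state-spectroscopy` at one step `k`, abstract form): if every `a ∈ 𝒜` is pure off the
vacuum and there are no dark light states, then EVERY vector orthogonal to the vacuum is pure,
i.e. `‖T|_{Ω^⊥}‖ ≤ θ` (`TransferData.HasMassGap (−log θ)` in the tree's vocabulary). Content:
purity set = closed `T`-invariant subspace (L2) ⊇ closed cyclic span `Z` of `𝒜`; `Z^⊥ ∩ Ω^⊥`
pure by hypothesis; `Z ⊕ Z^⊥ = H`, sums of pure vectors pure (L2). -/
def FullGapFromNoDark : Prop :=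
  ∀ (H : Type) [NormedAddCommGroup H] [InnerProductSpace ℂ H] [CompleteSpace H]
    (D : TransferData H) (𝒜 : Set H) (θ : ℝ), 0 < θ → θ ≤ 1 →
      (∀ a ∈ 𝒜, (a - ⟪D.vacuum, a⟫_ℂ • D.vacuum) ∈ puritySet D.T θ) →
        NoDarkLightStates D 𝒜 θ →
          ∀ v : H, ⟪D.vacuum, v⟫_ℂ = 0 → v ∈ puritySet D.T θ

end Dark

end

end Summit.QuantumFields.YangMills.Cruxes.GapToContinuum.SketchIdeator2
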